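import Summits.Ventures.LatticeQCDFlow.Scaling.DominatedStarRegimeFreeTimeAverages
import Summits.Ventures.LatticeQCDFlow.Scaling.DominatedStarLogSobolevMixing

/-!
HONEST FRAMING: exact (Metropolis-corrected) sampling algorithms for lattice gauge theory; figures
of merit are autocorrelation/cost numbers at stated couplings and volumes; no continuum-physics
claim.

# HalfSwapStarRecipe — THE REGIME-FREE NUMBERS OF THE HALF-SWAP STAR WITH EXACT HOT REDRAWS AND PER-ENTRY MAPS, AS ONE RECIPE:
# `γ⋆ ≥ p/(14K)`, `t_rel ≤ 14K/p`, `t_mix(ε) ≤ ⌈(14K/p)·log(1/(2ε·π̃_min))⌉`, `t_mix(ε) ≤ ⌈(28K/(p·α₀))·(log log(1/π̃_min) + log(1/(2ε²)))⌉`,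
# AND THE HONEST SAMPLE SIZE FROM EVERY START WITH EITHER BURN-IN (lean-2 GEN-28, ours)

Venture-side (OURS).  Cell `lqcd-flow` (pub-lqcd), unit `pub-lqcd-lean-2-g28`, 2026-08-28.  Chapter N, file 17: the user-facing specialisation
of `Scaling/DominatedStarRegimeFreeRelaxation` (N4), `…TimeAverages` (N8) and `Scaling/DominatedStarLogSobolevMixing` (N14) to the scheme an
implementation would actually run — swap weight `t = ½`, all refresh weight on the exact hot redraw (`w_0 = 1`), every hub edge `(0,k)` listed
`≥ c ≥ 1` times among `m ≤ cK` entries, each entry proposing through its own measure-preserving bijection `φ_r`, one-sided transported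
domination `p·μ_k(φ_r u) ≤ μ_0(u)` on the entries.  Then `p·min{c·½/(3m), ½/(7K)} ≥ p/(14K)` and every statement of the chapter reads with
the single constant `14K/p` (`28K/(p·α₀)` for the entropy route, `α₀` a common log-Sobolev floor of the single-level exact redraws).  NO
condition `4t ≤ p(1−t)w_0`.

## What is proved

* **`halfStar_absSpectralGap_ge`** — `γ⋆ ≥ p/(14K)`; **`halfStar_relaxationTime_le`** — `t_rel ≤ 14K/p`.
* **`halfStar_mixingTime_le`** — `t_mix(ε) ≤ ⌈(14K/p)·log(1/(2ε·π̃_min))⌉` (`0 < π̃_min ≤ π̃`).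
* **`halfStar_mixingTime_le_logSobolev`** — `t_mix(ε) ≤ ⌈(28K/(p·α₀))·(log log(1/π̃_min) + log(1/(2ε²)))⌉` (`0 < α₀ ≤ α(μ_k-redraw)` for
  every `k`, `π̃_min < 1`).
* **`halfStar_timeAverage`** — from EVERY start `x`: burn-in `r ≥ ⌈(14K/p)·log(1/(ε·π̃_min))⌉`, run `N ≥ 1` with
  `N ≥ (4Var_π̃(f)/(η²ε))·(14K/p)` ⇒ `P_x{|N⁻¹Σ_{s<N} f(X_{r+s}) − E_π̃ f| ≥ η} ≤ ε`.
* **`halfStar_timeAverage_logSobolevBurnIn`** — the same with the burn-in `r ≥ ⌈(28K/(p·α₀))·(log log(1/π̃_min) + log(2/ε²))⌉`.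

Reading (no numerics implied): the only place the volume enters is the burn-in, once through `log(1/π̃_min)` or — with single-level
log-Sobolev floors — through `log log(1/π̃_min)`; the run length is `(14K/p)·4Var/(η²ε)` swap-or-redraw attempts regardless.  NOT CLAIMED: a
burn-in free of `π̃_min` (OPEN-MATH-chapterM item 1 stays open); anything measured.  Literature grade (cell rule): OWN COMPOSITION on N4/N8/N14
and the typed [LevinPeres2017, Thm 12.21] bound of `Literature/Probability/MarkovChains/TimeAverageConcentration`; nothing new cited as a fact.
-/

noncomputable section

open Finset Function Matrix
open Literature.Probability.MarkovChains

namespace Summit.Ventures.LatticeQCDFlow.Scaling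

variable {S : Type*} [Fintype S] [DecidableEq S] {K m : ℕ} {μ : Fin (K + 1) → S → ℝ} {M : Fin (K + 1) → S → S → ℝ}
  {w : Fin (K + 1) → ℝ} {p : ℝ}

/-- `⌈a·L⌉ ≤ ⌈b·L⌉` for `0 ≤ a ≤ b` and ANY real `L` (for `L < 0` the left ceiling is `0`). -/
theorem natCeil_mul_mono_left {a b L : ℝ} (ha : 0 ≤ a) (hab : a ≤ b) : ⌈a * L⌉₊ ≤ ⌈b * L⌉₊ := by
  by_cases hL : 0 ≤ L
  · exact Nat.ceil_mono (mul_le_mul_of_nonneg_right hab hL)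
  · push Not at hL
    rw [Nat.ceil_eq_zero.mpr (mul_nonpos_of_nonneg_of_nonpos ha hL.le)]
    exact Nat.zero_le _

/-- The half-swap star's constant: `1/(14K) ≤ min{c·½/(3m), (1 − ½)·w_0/(7K)}` when `w_0 = 1` and `m ≤ cK`. -/
theorem halfStar_min_ge (hK : 1 ≤ K) (hm : 1 ≤ m) (hw01 : w 0 = 1) {c : ℕ} (hmcK : (m : ℝ) ≤ c * K) :
    1 / (14 * (K : ℝ)) ≤ min (c * (1 / 2 : ℝ) / (3 * m)) ((1 - 1 / 2) * w 0 / (7 * K)) := by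
  have hKpos : (0 : ℝ) < K := Nat.cast_pos.mpr (by omega)
  have hmpos : (0 : ℝ) < m := Nat.cast_pos.mpr (by omega)
  refine le_min ?_ ?_
  · rw [div_le_div_iff₀ (by positivity) (by positivity)]
    nlinarith
  · rw [hw01]
    apply le_of_eq; ring

/-- `1/(p·min{…}) ≤ 14K/p` for the half-swap star. -/
theorem halfStar_inv_le (hK : 1 ≤ K) (hm : 1 ≤ m) (hw01 : w 0 = 1) (hp0 : 0 < p) {c : ℕ} (hmcK : (m : ℝ) ≤ c * K) :
    1 / (p * min (c * (1 / 2 : ℝ) / (3 * m)) ((1 - 1 / 2) * w 0 / (7 * K))) ≤ 14 * K / p := by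
  have hKpos : (0 : ℝ) < K := Nat.cast_pos.mpr (by omega)
  have h14 : 0 < 1 / (14 * (K : ℝ)) := by positivity
  have hminpos : 0 < min (c * (1 / 2 : ℝ) / (3 * m)) ((1 - 1 / 2) * w 0 / (7 * K)) :=
    h14.trans_le (halfStar_min_ge hK hm hw01 hmcK)
  calc 1 / (p * min (c * (1 / 2 : ℝ) / (3 * m)) ((1 - 1 / 2) * w 0 / (7 * K))) ≤ 1 / (p * (1 / (14 * K))) :=
        one_div_le_one_div_of_le (mul_pos hp0 h14) (mul_le_mul_of_nonneg_left (halfStar_min_ge hK hm hw01 hmcK) hp0.le)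
    _ = 14 * K / p := by field_simp

section Recipe
variable (κ : Fin m → Fin K) (φ : Fin m → Equiv.Perm S)

/-- **`γ⋆ ≥ p/(14K)`** for the half-swap star with exact hot redraws and per-entry maps, NO REGIME. [ours] -/
theorem halfStar_absSpectralGap_ge [Nontrivial S] (hK : 1 ≤ K) (hm : 1 ≤ m) (hw0 : ∀ k, 0 ≤ w k) (hw01 : w 0 = 1)
    (hw1 : ∑ k, w k = 1) (hμ : ∀ k x, 0 < μ k x) (hμ1 : ∀ k, ∑ u, μ k u = 1) (hM : ∀ k, IsRowStochastic (M k))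
    (hMrev : ∀ k, DetailedBalance (μ k) (M k)) (hM0 : ∀ u v, M 0 u v = μ 0 v) (hp0 : 0 < p) (hp1 : p ≤ 1)
    (hdom : ∀ r u, p * μ (κ r).succ (φ r u) ≤ μ 0 u)
    {c : ℕ} (hc1 : 1 ≤ c) (hc : ∀ p' : Fin K, c ≤ (univ.filter (fun r : Fin m => κ r = p')).card)
    (hmcK : (m : ℝ) ≤ c * K) :
    p / (14 * K) ≤ absSpectralGap (fun y z : Fin (K + 1) → S =>
        (1 / 2 : ℝ) * ptGraphSwap μ (fun r : Fin m => (((0 : Fin (K + 1)), (κ r).succ) : Fin (K + 1) × Fin (K + 1))) φ y z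
          + (1 - 1 / 2) * prodKernel w M y z) := by
  have h := dominatedStar_absSpectralGap_ge_regimeFree κ φ hK hm (by norm_num : (0 : ℝ) < 1 / 2) (by norm_num) hw0
    (by rw [hw01]; exact one_pos) hw1 hμ hμ1 hM hMrev hM0 hp0 hp1 hdom hc1 hc
  refine le_trans ?_ h
  have := mul_le_mul_of_nonneg_left (halfStar_min_ge hK hm hw01 hmcK) hp0.le
  calc p / (14 * K) = p * (1 / (14 * K)) := by ring
    _ ≤ _ := this

/-- **`t_rel ≤ 14K/p`** for the half-swap star, NO REGIME. [ours] -/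
theorem halfStar_relaxationTime_le [Nontrivial S] (hK : 1 ≤ K) (hm : 1 ≤ m) (hw0 : ∀ k, 0 ≤ w k) (hw01 : w 0 = 1)
    (hw1 : ∑ k, w k = 1) (hμ : ∀ k x, 0 < μ k x) (hμ1 : ∀ k, ∑ u, μ k u = 1) (hM : ∀ k, IsRowStochastic (M k))
    (hMrev : ∀ k, DetailedBalance (μ k) (M k)) (hM0 : ∀ u v, M 0 u v = μ 0 v) (hp0 : 0 < p) (hp1 : p ≤ 1)
    (hdom : ∀ r u, p * μ (κ r).succ (φ r u) ≤ μ 0 u)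
    {c : ℕ} (hc1 : 1 ≤ c) (hc : ∀ p' : Fin K, c ≤ (univ.filter (fun r : Fin m => κ r = p')).card)
    (hmcK : (m : ℝ) ≤ c * K) :
    relaxationTime (fun y z : Fin (K + 1) → S =>
        (1 / 2 : ℝ) * ptGraphSwap μ (fun r : Fin m => (((0 : Fin (K + 1)), (κ r).succ) : Fin (K + 1) × Fin (K + 1))) φ y z
          + (1 - 1 / 2) * prodKernel w M y z) ≤ 14 * K / p :=
  (dominatedStar_relaxationTime_le_regimeFree κ φ hK hm (by norm_num : (0 : ℝ) < 1 / 2) (by norm_num) hw0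
    (by rw [hw01]; exact one_pos) hw1 hμ hμ1 hM hMrev hM0 hp0 hp1 hdom hc1 hc).trans (halfStar_inv_le hK hm hw01 hp0 hmcK)

/-- **`t_mix(ε) ≤ ⌈(14K/p)·log(1/(2ε·π̃_min))⌉`** for the half-swap star, NO REGIME (`0 < π̃_min ≤ π̃`). [ours] -/
theorem halfStar_mixingTime_le [Nontrivial S] (hK : 1 ≤ K) (hm : 1 ≤ m) (hw0 : ∀ k, 0 ≤ w k) (hw01 : w 0 = 1)
    (hw1 : ∑ k, w k = 1) (hμ : ∀ k x, 0 < μ k x) (hμ1 : ∀ k, ∑ u, μ k u = 1) (hM : ∀ k, IsRowStochastic (M k))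
    (hMrev : ∀ k, DetailedBalance (μ k) (M k)) (hM0 : ∀ u v, M 0 u v = μ 0 v) (hp0 : 0 < p) (hp1 : p ≤ 1)
    (hdom : ∀ r u, p * μ (κ r).succ (φ r u) ≤ μ 0 u)
    {c : ℕ} (hc1 : 1 ≤ c) (hc : ∀ p' : Fin K, c ≤ (univ.filter (fun r : Fin m => κ r = p')).card)
    (hmcK : (m : ℝ) ≤ c * K) {πmin : ℝ} (hmin0 : 0 < πmin) (hmin : ∀ x, πmin ≤ tensorFun μ x) {ε : ℝ} (hε : 0 < ε) :
    mixingTime (fun y z : Fin (K + 1) → S =>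
        (1 / 2 : ℝ) * ptGraphSwap μ (fun r : Fin m => (((0 : Fin (K + 1)), (κ r).succ) : Fin (K + 1) × Fin (K + 1))) φ y z
          + (1 - 1 / 2) * prodKernel w M y z) (tensorFun μ) ε ≤ ⌈14 * K / p * Real.log (1 / (2 * ε * πmin))⌉₊ := by
  have hKpos : (0 : ℝ) < K := Nat.cast_pos.mpr (by omega)
  have h := dominatedStar_mixingTime_le_regimeFree κ φ hK hm (by norm_num : (0 : ℝ) < 1 / 2) (by norm_num) hw0
    (by rw [hw01]; exact one_pos) hw1 hμ hμ1 hM hMrev hM0 hp0 hp1 hdom hc1 hc hmin0 hmin hε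
  refine h.trans (natCeil_mul_mono_left ?_ (halfStar_inv_le hK hm hw01 hp0 hmcK))
  have h14 : 0 < 1 / (14 * (K : ℝ)) := by positivity
  exact (one_div_pos.mpr (mul_pos hp0 (h14.trans_le (halfStar_min_ge hK hm hw01 hmcK)))).le

/-- **`t_mix(ε) ≤ ⌈(28K/(p·α₀))·(log log(1/π̃_min) + log(1/(2ε²)))⌉`** for the half-swap star, NO REGIME — `α₀ > 0` a common
floor of the logarithmic Sobolev constants of the single-level exact redraws `(u,v) ↦ μ_k(v)`, `0 < π̃_min ≤ π̃`, `π̃_min < 1`. [ours] -/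
theorem halfStar_mixingTime_le_logSobolev [Nontrivial S] (hK : 1 ≤ K) (hm : 1 ≤ m) (hw0 : ∀ k, 0 ≤ w k) (hw01 : w 0 = 1)
    (hw1 : ∑ k, w k = 1) (hμ : ∀ k x, 0 < μ k x) (hμ1 : ∀ k, ∑ u, μ k u = 1) (hM : ∀ k, IsRowStochastic (M k))
    (hMrev : ∀ k, DetailedBalance (μ k) (M k)) (hM0 : ∀ u v, M 0 u v = μ 0 v) (hp0 : 0 < p) (hp1 : p ≤ 1)
    (hdom : ∀ r u, p * μ (κ r).succ (φ r u) ≤ μ 0 u)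
    {c : ℕ} (hc1 : 1 ≤ c) (hc : ∀ p' : Fin K, c ≤ (univ.filter (fun r : Fin m => κ r = p')).card)
    (hmcK : (m : ℝ) ≤ c * K) {α₀ : ℝ} (hα0 : 0 < α₀) (hα : ∀ k, α₀ ≤ logSobolevConst (μ k) (fun _ v : S => μ k v))
    {πmin : ℝ} (hmin0 : 0 < πmin) (hmin1 : πmin < 1) (hmin : ∀ x, πmin ≤ tensorFun μ x) {ε : ℝ} (hε : 0 < ε) :
    mixingTime (fun y z : Fin (K + 1) → S =>
        (1 / 2 : ℝ) * ptGraphSwap μ (fun r : Fin m => (((0 : Fin (K + 1)), (κ r).succ) : Fin (K + 1) × Fin (K + 1))) φ y z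
          + (1 - 1 / 2) * prodKernel w M y z) (tensorFun μ) ε
      ≤ ⌈28 * K / (p * α₀) * (Real.log (Real.log (1 / πmin)) + Real.log (1 / (2 * ε ^ 2)))⌉₊ := by
  have hKpos : (0 : ℝ) < K := Nat.cast_pos.mpr (by omega)
  have hKr : (1 : ℝ) ≤ K := by exact_mod_cast hK
  have hmpos : (0 : ℝ) < m := Nat.cast_pos.mpr (by omega)
  have hG0 : 0 < p / (14 * K) := by positivity
  have hG1 : p / (14 * K) * (3 * m) ≤ p * c * (1 / 2 : ℝ) := by
    rw [div_mul_eq_mul_div, div_le_iff₀ (by positivity)]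
    nlinarith [mul_le_mul_of_nonneg_left hmcK hp0.le]
  have hG2 : p / (14 * K) * (p + 6 * K) ≤ p * 1 * (1 - 1 / 2) * w 0 := by
    rw [hw01, div_mul_eq_mul_div, div_le_iff₀ (by positivity)]
    nlinarith [mul_le_mul_of_nonneg_left (hp1.trans hKr) hp0.le]
  have h := dominatedStar_mixingTime_le_logSobolev κ φ hm hμ hμ1 hM hMrev hM0 hw0 hw1 (by rw [hw01]; exact one_pos)
    (by norm_num : (0 : ℝ) < 1 / 2) (by norm_num) hp0 hdom hc1 hc hG0 hG1 hG2 hα0 hα hmin0 hmin1 hmin hε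
  refine h.trans (le_of_eq ?_)
  congr 1
  rw [hw01]
  field_simp
  ring

/-- **HONEST SAMPLE SIZE FROM EVERY START, half-swap star, NO REGIME:** burn-in `r ≥ ⌈(14K/p)·log(1/(ε·π̃_min))⌉`, run `N ≥ 1`
with `N ≥ (4Var_π̃(f)/(η²ε))·(14K/p)` ⇒ `P_x{|N⁻¹Σ_{s<N} f(X_{r+s}) − E_π̃ f| ≥ η} ≤ ε`. [ours] -/
theorem halfStar_timeAverage [Nontrivial S] (hK : 1 ≤ K) (hm : 1 ≤ m) (hw0 : ∀ k, 0 ≤ w k) (hw01 : w 0 = 1)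
    (hw1 : ∑ k, w k = 1) (hμ : ∀ k x, 0 < μ k x) (hμ1 : ∀ k, ∑ u, μ k u = 1) (hM : ∀ k, IsRowStochastic (M k))
    (hMrev : ∀ k, DetailedBalance (μ k) (M k)) (hM0 : ∀ u v, M 0 u v = μ 0 v) (hp0 : 0 < p) (hp1 : p ≤ 1)
    (hdom : ∀ r u, p * μ (κ r).succ (φ r u) ≤ μ 0 u)
    {c : ℕ} (hc1 : 1 ≤ c) (hc : ∀ p' : Fin K, c ≤ (univ.filter (fun r : Fin m => κ r = p')).card)
    (hmcK : (m : ℝ) ≤ c * K) {πmin : ℝ} (hmin0 : 0 < πmin) (hmin : ∀ x, πmin ≤ tensorFun μ x)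
    (f : (Fin (K + 1) → S) → ℝ) {ε η : ℝ} (hε : 0 < ε) (hη : 0 < η) {r N : ℕ}
    (hr : ⌈14 * K / p * Real.log (1 / (ε * πmin))⌉₊ ≤ r) (hN : 0 < N)
    (hNvar : 4 * lawVariance (tensorFun μ) f / (η ^ 2 * ε) * (14 * K / p) ≤ N) (x : Fin (K + 1) → S) :
    pathSum (fun y z : Fin (K + 1) → S =>
        (1 / 2 : ℝ) * ptGraphSwap μ (fun r : Fin m => (((0 : Fin (K + 1)), (κ r).succ) : Fin (K + 1) × Fin (K + 1))) φ y z
          + (1 - 1 / 2) * prodKernel w M y z) (N + r) x (fun ω =>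
        if η ≤ |(∑ s : Fin N, f ((Matrix.vecCons x ω : Fin (N + r + 1) → (Fin (K + 1) → S))
              ⟨(s : ℕ) + r, by have := s.isLt; omega⟩)) / N - lawMean (tensorFun μ) f|
          then (1 : ℝ) else 0) ≤ ε := by
  have hKpos : (0 : ℝ) < K := Nat.cast_pos.mpr (by omega)
  have hinv := halfStar_inv_le hK hm hw01 hp0 hmcK
  have h14 : 0 < 1 / (14 * (K : ℝ)) := by positivity
  have hinv0 : 0 ≤ 1 / (p * min (c * (1 / 2 : ℝ) / (3 * m)) ((1 - 1 / 2) * w 0 / (7 * K))) :=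
    (one_div_pos.mpr (mul_pos hp0 (h14.trans_le (halfStar_min_ge hK hm hw01 hmcK)))).le
  have hV : 0 ≤ 4 * lawVariance (tensorFun μ) f / (η ^ 2 * ε) :=
    div_nonneg (mul_nonneg (by norm_num) (lawVariance_nonneg (fun z => (tensorFun_pos hμ z).le) f)) (by positivity)
  exact dominatedStar_timeAverage_regimeFree κ φ hK hm (by norm_num : (0 : ℝ) < 1 / 2) (by norm_num) hw0
    (by rw [hw01]; exact one_pos) hw1 hμ hμ1 hM hMrev hM0 hp0 hp1 hdom hc1 hc hmin0 hmin f hε hη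
    ((natCeil_mul_mono_left hinv0 hinv).trans hr) hN ((mul_le_mul_of_nonneg_left hinv hV).trans hNvar) x

/-- **HONEST SAMPLE SIZE FROM EVERY START WITH THE `log log` BURN-IN, half-swap star, NO REGIME:** burn-in
`r ≥ ⌈(28K/(p·α₀))·(log log(1/π̃_min) + log(2/ε²))⌉`, run `N ≥ 1` with `N ≥ (4Var_π̃(f)/(η²ε))·(14K/p)` ⇒
`P_x{|N⁻¹Σ_{s<N} f(X_{r+s}) − E_π̃ f| ≥ η} ≤ ε` (`α₀`, `π̃_min` as in `halfStar_mixingTime_le_logSobolev`). [ours] -/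
theorem halfStar_timeAverage_logSobolevBurnIn [Nontrivial S] (hK : 1 ≤ K) (hm : 1 ≤ m) (hw0 : ∀ k, 0 ≤ w k) (hw01 : w 0 = 1)
    (hw1 : ∑ k, w k = 1) (hμ : ∀ k x, 0 < μ k x) (hμ1 : ∀ k, ∑ u, μ k u = 1) (hM : ∀ k, IsRowStochastic (M k))
    (hMrev : ∀ k, DetailedBalance (μ k) (M k)) (hM0 : ∀ u v, M 0 u v = μ 0 v) (hp0 : 0 < p) (hp1 : p ≤ 1)
    (hdom : ∀ r u, p * μ (κ r).succ (φ r u) ≤ μ 0 u)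
    {c : ℕ} (hc1 : 1 ≤ c) (hc : ∀ p' : Fin K, c ≤ (univ.filter (fun r : Fin m => κ r = p')).card)
    (hmcK : (m : ℝ) ≤ c * K) {α₀ : ℝ} (hα0 : 0 < α₀) (hα : ∀ k, α₀ ≤ logSobolevConst (μ k) (fun _ v : S => μ k v))
    {πmin : ℝ} (hmin0 : 0 < πmin) (hmin1 : πmin < 1) (hmin : ∀ x, πmin ≤ tensorFun μ x)
    (f : (Fin (K + 1) → S) → ℝ) {ε η : ℝ} (hε : 0 < ε) (hη : 0 < η) {r N : ℕ}
    (hr : ⌈28 * K / (p * α₀) * (Real.log (Real.log (1 / πmin)) + Real.log (2 / ε ^ 2))⌉₊ ≤ r) (hN : 0 < N)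
    (hNvar : 4 * lawVariance (tensorFun μ) f / (η ^ 2 * ε) * (14 * K / p) ≤ N) (x : Fin (K + 1) → S) :
    pathSum (fun y z : Fin (K + 1) → S =>
        (1 / 2 : ℝ) * ptGraphSwap μ (fun r : Fin m => (((0 : Fin (K + 1)), (κ r).succ) : Fin (K + 1) × Fin (K + 1))) φ y z
          + (1 - 1 / 2) * prodKernel w M y z) (N + r) x (fun ω =>
        if η ≤ |(∑ s : Fin N, f ((Matrix.vecCons x ω : Fin (N + r + 1) → (Fin (K + 1) → S))
              ⟨(s : ℕ) + r, by have := s.isLt; omega⟩)) / N - lawMean (tensorFun μ) f|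
          then (1 : ℝ) else 0) ≤ ε := by
  have hKpos : (0 : ℝ) < K := Nat.cast_pos.mpr (by omega)
  have hw00 : 0 < w 0 := by rw [hw01]; exact one_pos
  have ht0 : (0 : ℝ) < 1 / 2 := by norm_num
  have ht1 : (1 / 2 : ℝ) < 1 := by norm_num
  have hP := weightedScheme_isRowStochastic (t := (1 / 2 : ℝ)) (w := w)
    (ptGraphSwap_isRowStochastic (e := fun r : Fin m => (((0 : Fin (K + 1)), (κ r).succ) : Fin (K + 1) × Fin (K + 1)))
      (φ := φ) hμ) hM hw0 hw1 ht0.le ht1.le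
  have hDB := weightedScheme_detailedBalance (w := w)
    (ptGraphSwap_detailedBalance (e := fun r : Fin m => (((0 : Fin (K + 1)), (κ r).succ) : Fin (K + 1) × Fin (K + 1)))
      (φ := φ) hμ) hMrev (1 / 2 : ℝ)
  have hirr := dominatedStar_isIrreducible_regimeFree κ φ ht0 ht1 hw0 hw00 hw1 hμ hM hM0 hc1 hc
  have hε2 : 0 < ε / 2 := by linarith
  -- a witness that `d(·) ≤ ε/2` is attained (the spectral burn-in), and the `log log` bound on `t_mix(ε/2)`
  have ht₀ := dominatedStar_worstTvDist_le_regimeFree κ φ hK hm ht0 ht1 hw0 hw00 hw1 hμ hμ1 hM hMrev hM0 hp0 hp1 hdom hc1 hc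
    hmin0 hmin hε2 (Nat.le_ceil _)
  have hlog : Real.log (1 / (2 * (ε / 2) ^ 2)) = Real.log (2 / ε ^ 2) := by
    congr 1; field_simp
  have hmix : mixingTime (fun y z : Fin (K + 1) → S =>
      (1 / 2 : ℝ) * ptGraphSwap μ (fun r : Fin m => (((0 : Fin (K + 1)), (κ r).succ) : Fin (K + 1) × Fin (K + 1))) φ y z
        + (1 - 1 / 2) * prodKernel w M y z) (tensorFun μ) (ε / 2) ≤ r := by
    have h := halfStar_mixingTime_le_logSobolev κ φ hK hm hw0 hw01 hw1 hμ hμ1 hM hMrev hM0 hp0 hp1 hdom hc1 hc hmcK hα0 hα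
      hmin0 hmin1 hmin hε2
    rw [hlog] at h
    exact h.trans hr
  -- the run length through `Gap ≥ γ⋆ ≥ p/(14K)`
  have hgap : p / (14 * K) ≤ spectralGap (tensorFun μ) (fun y z : Fin (K + 1) → S =>
      (1 / 2 : ℝ) * ptGraphSwap μ (fun r : Fin m => (((0 : Fin (K + 1)), (κ r).succ) : Fin (K + 1) × Fin (K + 1))) φ y z
        + (1 - 1 / 2) * prodKernel w M y z) :=
    (halfStar_absSpectralGap_ge κ φ hK hm hw0 hw01 hw1 hμ hμ1 hM hMrev hM0 hp0 hp1 hdom hc1 hc hmcK).trans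
      (absSpectralGap_le_spectralGap (fun z => tensorFun_pos hμ z) (sum_tensorFun_eq_one _ hμ1) hP hDB hirr)
  have hG0 : 0 < p / (14 * K) := by positivity
  have hγinv : (spectralGap (tensorFun μ) (fun y z : Fin (K + 1) → S =>
      (1 / 2 : ℝ) * ptGraphSwap μ (fun r : Fin m => (((0 : Fin (K + 1)), (κ r).succ) : Fin (K + 1) × Fin (K + 1))) φ y z
        + (1 - 1 / 2) * prodKernel w M y z))⁻¹ ≤ 14 * K / p := by
    calc _ ≤ (p / (14 * K))⁻¹ := by rw [inv_le_inv₀ (hG0.trans_le hgap) hG0]; exact hgap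
      _ = 14 * K / p := by rw [inv_div]
  have hV : 0 ≤ 4 * lawVariance (tensorFun μ) f / (η ^ 2 * ε) :=
    div_nonneg (mul_nonneg (by norm_num) (lawVariance_nonneg (fun z => (tensorFun_pos hμ z).le) f)) (by positivity)
  exact LevinPeres2017_thm_12_21 (fun z => tensorFun_pos hμ z) (sum_tensorFun_eq_one _ hμ1) hP hDB hirr f hε hη ht₀ hmix hN
    ((mul_le_mul_of_nonneg_left hγinv hV).trans hNvar) x

end Recipe

end Summit.Ventures.LatticeQCDFlow.Scaling

end
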